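import Summits.QuantumFields.BalabanUV.T4Continuum.Spine.NE3.LeafIndexSockets
import Summits.QuantumFields.BalabanUV.T4Continuum.Support.RegularSupOfGauge
import Summits.QuantumFields.BalabanUV.T4Continuum.Support.MinimalActionDictionary
import Literature.MathematicalPhysics.QuantumFieldTheory.Balaban1983to89.Node00.RateRecord11NE3Data
import HarnessLib

/-!
# Route «BalabanUVNodes» (K3⁷ `SpineGivenEndpointR13SepCoPH`, stmt-QuantumFields-20544), DAG node N16 = NE3 — THE N07 → N16 EDGE `h7`
# (the sup-form Thm-1-TYPE leaf `LeafH3sup` at the NE3 objects of the record) IN PRINT'S CURRENCY: (i) its content is ONE pointwise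
# flux-gradient clause; (ii) it follows from [B11] Thm 1 (9)_{β₀=1}-TYPE local gauges at the tree's minimisers (S3 dictionary BY NAME);
# (iii) from [B11] THEOREM 1 READ AT leaf-06's TORUS INSTANCES `B11Thm1.Thm1At C (torusVP d L N G (k+1))` it follows ON LOOSE DATA

Cell `pub-ymgap`, width seat `pub-ymgap-dag-n16-w1` (director-ym №197 ∕ HUMAN RULING D-0149; plan g77 `W-SEAT-START-LIST.md` v2 §2 n16 item 1 =
(W1) THE N07-EDGE), generation 0.  `--kind proof --supports stmt-QuantumFields-20544 --as helper` (count-neutral).  `bears_on: R4∕N16 · edge N07 → N16`.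

WHAT `h7` IS.  dag-n16-e's N16 discharge test under the R-β pick (evidence #6 on stmt-QuantumFields-20544, `N16DischargeTest.lean`) closes node N16 at
the Stage-13 reading of record from exactly two sorried stubs; `stub_h7 (F : T4Family) : ∃ C ε₀, 0 ≤ C ∧ 0 < ε₀ ∧ ∀ ε, 0 < ε → ε ≤ ε₀ →
LeafH3sup 4 F.L (ne3NperOfRecord₁₁ F 0 0) ε (C*ε) (C*ε) (ne3DomOfRecord₁₁ F N 0 0)` is the N07 edge: every minimiser of the Wilson action (5) of
[Balaban1985Variational] over the tree's small-field class `MinimalActionRate.sfClass` (run `k+1`, [Balaban1985Averaging] (42)-constraint `avgIter L U (k+1) = V`)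
is `MinimalActionRefine.RegularSup` with linear letters — [Balaban1985Variational] Theorem 1 (8)–(10) p. 279 TYPE (`Spine/NE3/LeafIndexSockets.lean` :61).

WHAT THIS FILE PROVES (kernel, theorems only, 0 `def`, 0 sorry; everything BY NAME over landed modules).
* §1 `leafH3sup_of_fluxGrad` ∕ `fluxGrad_of_leafH3sup` ∕ `leafH3sup_mono` — THE CONTENT OF `h7` IS ONE CLAUSE: of `RegularSup`'s four fields, `unitary`, `periodic`
  and `small` (radius `b ≥ ε`) are FREE from membership in `sfClass`; what is asked is the pointwise (10)-TYPE flux-gradient bound at minimisers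
  `‖(∇_U F)(x,κ;π)‖ ≤ c∕(L^{k+1})³` (`T4AveragingDeficitWall.covGrad ∕ flux`).
* §2 `leafH3sup_of_reg9AtMinimisers` — (9)_{β₀=1}-TYPE AT THE TREE'S MINIMISERS ⟹ `LeafH3sup`: if every minimiser of run `k+1` admits about every site a unitary
  gauge `u` with `U^u = exp a` on the bonds within `|·|₁ ≤ 2`, `‖a‖ ≤ A₀ε∕L^{k+1}`, `‖∇a‖ ≤ A₁ε∕L^{2(k+1)}`, `‖∇∇a(x)‖ ≤ A₂ε∕L^{3(k+1)}` — print's (9)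
  «|A| < B₃Mε₁(Lʲη)⁻¹, |∇^ηA| < B₃Mε₁(Lʲη)⁻², ‖A‖_{1,β} < B₄(β₀)Mε₁(Lʲη)^{−2−β}, β ≤ β₀ = 1» read for the lattice potential `a = ηA`, `η = L^{−(k+1)}`, top cube
  scale `Lʲη = 1`, `ε₁ = ε∕B₃` — then `LeafH3sup d L N ε ε ((2A₂ + 90A₀A₁ + 32A₁² + 360A₀³)·ε) dom` for `ε ≤ 1∕2`, `A₀ε, A₁ε ≤ 1∕8`: NE3 P1's
  `RegularSupOfGauge.regularSup_of_localGauge` (g18) over row NE3-R2's `AveragingDeficitFluxExpansion.norm_covGrad_flux_le` + `AveragingDeficitKDatum.kRem_le'`,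
  with the level bookkeeping done here; `h7Shape_of_reg9AtMinimisers` (the `∃ C ε₀ ∀ ε ≤ ε₀` SHAPE of `stub_h7`, any `d, L, N, dom`, from constants
  `A₀ A₁ A₂ a` chosen BEFORE `ε` — print's quantifier order «a₀, a₁, B₃ depend on d and L only»); `h7_at_record_of_reg9AtMinimisers` (d = 4, `L = F.L`,
  `ne3NperOfRecord₁₁ F 0 0`, `ne3DomOfRecord₁₁ F N 0 0`: LITERALLY `stub_h7`'s statement, from the (9)-TYPE family hypothesis — dag-n16-e's knit slot).
* §3 `leafH3sup_loose_of_thm1At_torusVP` — ★ [B11] THEOREM 1 AT leaf-06's TORUS INSTANCES ⟹ `h7` ON LOOSE DATA: for ANY local-gauge shape `G` monotone in its radii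
  (`MinimalActionDictionary.RadiiMono`) and at least as fine as (9)_{β₀=1} sup data about the cube's centre (interface binder `hG`), constants `C : B11Thm1.Consts`
  with `M(ε₁) ≥ 7∕2` on `(0, a₁]`, and `∀ k, B11Thm1.Thm1At C (torusVP d L N G (k+1))` (Theorem 1 p. 279 for the instances of `MinimalActionDictionary` §4 — a
  DISPLAYED HYPOTHESIS, asserted for nothing): for `0 < ε ≤ min(B₃a₁, 1∕28)`,
  `LeafH3sup d L N ε ε (16937·ε) {V ∈ dom | V ∈ sfClass d L N (ε∕B₃) 0}` — Theorem 1 invoked at `ε₁ := ε∕B₃` (so that (8)'s radius `B₃ε₁` IS the tree's class radius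
  `ε`), hypothesis (7) = `torusVP.Reg7 ε₁ V` = «`V` unitary, `N`-periodic, `|V(∂p′) − 1| ≤ ε∕B₃`» (THE LOOSE DATA), the regularity cube `box K x`, `K = 2L^{k+1} + 1`
  (`cubeM ≤ 7∕2`, `MinimalActionDictionary.cubeM_slot_le`), `gauge_of_regularity` (common factor `t = 7ε∕2`), `hG`, §2's arithmetic; `h7Shape_loose_of_thm1At_torusVP`
  (the `∃ C ε₀` shape, `C = 16937`); `radiiMono_lipGauge` ∕ `interface_lipGauge` (the interface binders HOLD for the (9)_{β₀=1} sup shape on cubes — A6 hygiene: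
  `hGm`∕`hG` are jointly inhabited; `Thm1At` itself is Bałaban's theorem and is inhabited by nothing here).

LOCATED (first-hand, decl-level; HOME `pub-ymgap-dag-n16-w1/LOCATED-N16-H7-PRINT-GAP.md`).  `stub_h7` AS TYPED IS [B11]-Thm-1-TYPE BUT PRINT-STRONGER, on two counts
no carrier reading removes: (A1) `sfClass` is the PLAQUETTE-ONLY closed class; print's spaces (2)∕(6)∕(8) carry the current clause «|(D*_U∂U)(b)| < ε₀L^{−2j}(Lʲη)^{−1}»
([Balaban1985Variational] p. 278; leaf-06 D-s3-1; n07-a F7 for the torus of record) — a minimiser over `sfClass ε ∩ 𝔅(V)` is a print-minimal configuration only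
modulo the a-priori item «it lies in print's (6)(a₀)»; (A2) `h7` quantifies over ALL data `V ∈ dom` at ONE class radius `ε`, while Theorem 1 places the minimal orbit
in `𝔘_k(B₃ε₁)`, `ε₁` = the datum's (7)-size: at class radius `ε` print covers exactly the LOOSE data `|V(∂p′) − 1| < ε∕B₃` — §3's domain restriction is forced,
not chosen.  What print + kinematics DO give is §3; what N16's END consumes (`h7` on `ne3DomOfRecord₁₁` = all `2L^m`-periodic `SU(N)` data) exceeds it by A1 + A2.

HONEST FRAMING.  Bookkeeping ∕ dictionary over landed theorems BY NAME; NOTHING of Bałaban is asserted (`Thm1At` and the (9)-TYPE gauges are displayed hypotheses);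
`stub_h7` is NOT closed (print-stronger, A1∕A2); N16 ∕ NE3 NOT discharged; count-neutral; counts of record unmoved (typed 28∕28 · discharged 5∕27); one finite
four-torus at fixed `ε`, Bałaban AS PRINTED — NOT ℝ⁴, NOT infinite volume, NOT OS, NOT a mass gap; the YM mass gap (Clay) is NOT proved by any of this — R4 closes the
conditional finite-𝕋⁴ rung `BalabanLadder.UV` only.
-/

set_option autoImplicit false

open scoped BigOperators Matrix Matrix.Norms.L2Operator
open NormedSpace

namespace Summit.QuantumFields.YangMills.BalabanUVNodes.N16H7OfReg9

open Literature.MathematicalPhysics.QuantumFieldTheory.Balaban1983to89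
open B7Prop1Explicit B7Prop2Explicit MatrixLog UnitaryModel
open T4AveragingDeficitWall hiding Site Plane Plaq Bond
open T4AveragingDeficitWallBoundary (IsPeriodicCfg)
open T4Continuum (T4Family)
open Summit.QuantumFields.BalabanUV.T4Continuum
open AveragingDeficitLatticeH2Prep (fd)
open AveragingDeficitCounting (box_mono self_mem_box)
open AveragingDeficitKDatum (kRem kRem_le' kRem_nonneg' mem_box_add_of_l1)
open MinimalActionSandwich (IsMinimiser)
open MinimalActionRate (sfClass)
open MinimalActionRefine (RegularSup)
open MinimalActionDictionary (torusVP RadiiMono cubeM cubeM_slot_le gauge_of_regularity)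
open RegularSupOfGauge (regularSup_of_localGauge)
open NE3.LeafIndexSockets (LeafH3sup)
open B11 (Regularity)
open B11Thm1 (Thm1At Reg910)
open Node00 (ne3NperOfRecord₁₁ ne3DomOfRecord₁₁ MatA)

noncomputable section

variable {d : ℕ} {n : Type} [Fintype n] [DecidableEq n]

/-! ## §1 The content of `h7`: one pointwise flux-gradient clause at the minimisers -/

/-- **`h7`'S CONTENT IS THE (10)-TYPE FLUX-GRADIENT CLAUSE.**  If every minimiser of run `k+1` of the Wilson action over the small-field class
`sfClass d L N ε` with datum `V ∈ dom` obeys the pointwise bound `‖(∇_U F)(x,κ;π)‖ ≤ c∕(L^{k+1})³` at every bond and plane, then the sup-form Thm-1-TYPE leaf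
`LeafH3sup d L N ε b c dom` holds for every radius letter `b ≥ ε` — unitarity, `(N·L^{k+1})`-periodicity and the small-field radius `ε∕(L^{k+1})² ≤ b∕(L^{k+1})²` are
the minimiser's class membership (`MinimalActionSandwich.IsMinimiser.mem`).  Context: [Balaban1985Variational] Thm 1 (8)+(10) p. 279. [folklore] -/
theorem leafH3sup_of_fluxGrad {L N : ℕ} {ε b c : ℝ} (hεb : ε ≤ b) {dom : Set (Site d → Fin d → (Matrix n n ℂ)ˣ)}
    (h : ∀ V ∈ dom, ∀ (k : ℕ) (U : Site d → Fin d → (Matrix n n ℂ)ˣ), IsMinimiser d (sfClass d L N ε) L N (k + 1) V U →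
      ∀ (x : Site d) (κ : Fin d) (π : T4AveragingDeficitWall.Plane d), ‖covGrad U (flux U) x κ π‖ ≤ c / ((L : ℝ) ^ (k + 1)) ^ 3) :
    LeafH3sup d L N ε b c dom := by
  intro V hV k U hU
  obtain ⟨hu, hp, hs⟩ := hU.mem.1
  exact ⟨hu, hp, MinimalActionRate.SmallField.mono hs (div_le_div_of_nonneg_right hεb (by positivity)), h V hV k U hU⟩

/-- Conversely the leaf carries the flux-gradient clause (projection `RegularSup.grad`). [folklore] -/
theorem fluxGrad_of_leafH3sup {L N : ℕ} {ε b c : ℝ} {dom : Set (Site d → Fin d → (Matrix n n ℂ)ˣ)} (h : LeafH3sup d L N ε b c dom) :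
    ∀ V ∈ dom, ∀ (k : ℕ) (U : Site d → Fin d → (Matrix n n ℂ)ˣ), IsMinimiser d (sfClass d L N ε) L N (k + 1) V U →
      ∀ (x : Site d) (κ : Fin d) (π : T4AveragingDeficitWall.Plane d), ‖covGrad U (flux U) x κ π‖ ≤ c / ((L : ℝ) ^ (k + 1)) ^ 3 :=
  fun V hV k U hU => (h V hV k U hU).grad

/-- The leaf is monotone in its two letters (`RegularSup.mono`). [folklore] -/
theorem leafH3sup_mono {L N : ℕ} {ε b c b' c' : ℝ} {dom : Set (Site d → Fin d → (Matrix n n ℂ)ˣ)} (h : LeafH3sup d L N ε b c dom)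
    (hb : b ≤ b') (hc : c ≤ c') : LeafH3sup d L N ε b' c' dom :=
  fun V hV k U hU => (h V hV k U hU).mono hb hc

/-- The leaf is antitone in the data set. [folklore] -/
theorem leafH3sup_anti {L N : ℕ} {ε b c : ℝ} {dom dom' : Set (Site d → Fin d → (Matrix n n ℂ)ˣ)} (h : LeafH3sup d L N ε b c dom)
    (hsub : dom' ⊆ dom) : LeafH3sup d L N ε b c dom' :=
  fun V hV k U hU => h V (hsub hV) k U hU

/-! ## §2 (9)_{β₀=1}-TYPE local gauges at the tree's minimisers ⟹ `LeafH3sup` (S3 dictionary BY NAME, level bookkeeping here) -/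

/-- Level arithmetic of the remainder: with `t = L^{k+1} ≥ 1`, `0 ≤ ε ≤ 1` and the radii `α₀ = A₀ε∕t`, `α₁ = A₁ε∕t²`, `α₂ = A₂ε∕t³` (`A₀ε, A₁ε ≤ 1∕8`):
`(2α₂ + kRem α₀ α₁)·t³ ≤ (2A₂ + 90A₀A₁ + 32A₁² + 360A₀³)·ε`. [folklore] -/
theorem level_arith {t ε A₀ A₁ A₂ : ℝ} (ht : 1 ≤ t) (hε : 0 ≤ ε) (hε1 : ε ≤ 1) (hA₀ : 0 ≤ A₀) (hA₁ : 0 ≤ A₁)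
    (hA₀ε : A₀ * ε ≤ 1 / 8) (hA₁ε : A₁ * ε ≤ 1 / 8) :
    (2 * (A₂ * ε / t ^ 3) + kRem (A₀ * ε / t) (A₁ * ε / t ^ 2)) * t ^ 3 ≤ (2 * A₂ + 90 * A₀ * A₁ + 32 * A₁ ^ 2 + 360 * A₀ ^ 3) * ε := by
  have ht0 : 0 < t := by linarith
  have hα₀ : 0 ≤ A₀ * ε / t := by positivity
  have hα₁ : 0 ≤ A₁ * ε / t ^ 2 := by positivity
  have hα₀' : A₀ * ε / t ≤ 1 / 8 := (div_le_self (by positivity) ht).trans hA₀ε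
  have hα₁' : A₁ * ε / t ^ 2 ≤ 1 / 8 := (div_le_self (by positivity) (one_le_pow₀ ht)).trans hA₁ε
  have hk := kRem_le' hα₀ hα₁ hα₀' hα₁'
  -- the four monomials, each multiplied by `t³`
  have e2 : 2 * (A₂ * ε / t ^ 3) * t ^ 3 = 2 * A₂ * ε := by field_simp
  have e01 : (A₀ * ε / t) * (A₁ * ε / t ^ 2) * t ^ 3 = A₀ * A₁ * ε ^ 2 := by field_simp
  have e11 : (A₁ * ε / t ^ 2) ^ 2 * t ^ 3 = A₁ ^ 2 * ε ^ 2 / t := by field_simp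
  have e00 : (A₀ * ε / t) ^ 3 * t ^ 3 = A₀ ^ 3 * ε ^ 3 := by field_simp
  have hε2 : ε ^ 2 ≤ ε := by nlinarith
  have hε3 : ε ^ 3 ≤ ε := by nlinarith
  have h11 : A₁ ^ 2 * ε ^ 2 / t ≤ A₁ ^ 2 * ε := (div_le_self (by positivity) ht).trans (by nlinarith)
  have hkt : kRem (A₀ * ε / t) (A₁ * ε / t ^ 2) * t ^ 3 ≤ (90 * A₀ * A₁ + 32 * A₁ ^ 2 + 360 * A₀ ^ 3) * ε := by
    calc kRem (A₀ * ε / t) (A₁ * ε / t ^ 2) * t ^ 3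
        ≤ (90 * (A₀ * ε / t) * (A₁ * ε / t ^ 2) + 32 * (A₁ * ε / t ^ 2) ^ 2 + 360 * (A₀ * ε / t) ^ 3) * t ^ 3 :=
          mul_le_mul_of_nonneg_right hk (by positivity)
      _ = 90 * (A₀ * A₁ * ε ^ 2) + 32 * (A₁ ^ 2 * ε ^ 2 / t) + 360 * (A₀ ^ 3 * ε ^ 3) := by
          rw [← e01, ← e11, ← e00]; ring
      _ ≤ 90 * (A₀ * A₁ * ε) + 32 * (A₁ ^ 2 * ε) + 360 * (A₀ ^ 3 * ε) := by
          have h1 : A₀ * A₁ * ε ^ 2 ≤ A₀ * A₁ * ε := by nlinarith [mul_nonneg hA₀ hA₁]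
          have h3 : A₀ ^ 3 * ε ^ 3 ≤ A₀ ^ 3 * ε := by nlinarith [pow_nonneg hA₀ 3]
          linarith
      _ = (90 * A₀ * A₁ + 32 * A₁ ^ 2 + 360 * A₀ ^ 3) * ε := by ring
  calc (2 * (A₂ * ε / t ^ 3) + kRem (A₀ * ε / t) (A₁ * ε / t ^ 2)) * t ^ 3
      = 2 * (A₂ * ε / t ^ 3) * t ^ 3 + kRem (A₀ * ε / t) (A₁ * ε / t ^ 2) * t ^ 3 := by ring
    _ ≤ 2 * A₂ * ε + (90 * A₀ * A₁ + 32 * A₁ ^ 2 + 360 * A₀ ^ 3) * ε := by rw [e2]; linarith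
    _ = (2 * A₂ + 90 * A₀ * A₁ + 32 * A₁ ^ 2 + 360 * A₀ ^ 3) * ε := by ring

/-- **(9)_{β₀=1}-TYPE LOCAL GAUGES AT THE TREE'S MINIMISERS ⟹ THE LEAF (H3ˢᵘᵖ) WITH LINEAR LETTERS.**  Let `L ≥ 1`, `0 ≤ ε ≤ 1∕2`, `A₀, A₁ ≥ 0`, `A₂` real, with
`A₀ε, A₁ε ≤ 1∕8`.  Suppose every minimiser `U` of run `k+1` over `sfClass d L N ε` with datum `V ∈ dom` admits, about EVERY site `x`, a unitary gauge `u` with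
`U^u(b) = exp a(b)` on the bonds `b = (y, τ)` with `|y − x|₁ ≤ 2`, `‖a‖ ≤ A₀ε∕L^{k+1}` there, `‖∇_i a_τ(y)‖ ≤ A₁ε∕L^{2(k+1)}` for `|y − x|₁ ≤ 1` and
`‖∇_i∇_l a_τ(x)‖ ≤ A₂ε∕L^{3(k+1)}` — [Balaban1985Variational] Thm 1 (9) TYPE («|A|, |∇^ηA|, ‖A‖_{1,β₀=1}» for the lattice potential `a = ηA` at the top cube scale,
`ε₁ = ε∕B₃`).  THEN `LeafH3sup d L N ε ε ((2A₂ + 90A₀A₁ + 32A₁² + 360A₀³)·ε) dom` — `RegularSupOfGauge.regularSup_of_localGauge` BY NAME at every level, the level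
arithmetic being `level_arith`.  The gauge datum is a HYPOTHESIS (asserted for no configuration); NE3 is NOT proved. [folklore] -/
theorem leafH3sup_of_reg9AtMinimisers [Nonempty n] {L N : ℕ} (hL : 1 ≤ L) {ε A₀ A₁ A₂ : ℝ} (hε : 0 ≤ ε) (hε2 : ε ≤ 1 / 2)
    (hA₀ : 0 ≤ A₀) (hA₁ : 0 ≤ A₁) (hA₀ε : A₀ * ε ≤ 1 / 8) (hA₁ε : A₁ * ε ≤ 1 / 8)
    {dom : Set (Site d → Fin d → (Matrix n n ℂ)ˣ)}
    (h9 : ∀ V ∈ dom, ∀ (k : ℕ) (U : Site d → Fin d → (Matrix n n ℂ)ˣ), IsMinimiser d (sfClass d L N ε) L N (k + 1) V U →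
      ∀ x : Site d, ∃ (u : Site d → (Matrix n n ℂ)ˣ) (a : Site d → Fin d → Matrix n n ℂ),
        (∀ z, u z ∈ unitaryUnits (Matrix n n ℂ)) ∧
        (∀ (y : Site d) (τ : Fin d), l1 (y - x) ≤ 2 → ((gaugeAct u U y τ : (Matrix n n ℂ)ˣ) : Matrix n n ℂ) = exp (a y τ)) ∧
        (∀ (y : Site d) (τ : Fin d), l1 (y - x) ≤ 2 → ‖a y τ‖ ≤ A₀ * ε / (L : ℝ) ^ (k + 1)) ∧
        (∀ (y : Site d) (τ i : Fin d), l1 (y - x) ≤ 1 → ‖fd i (fun z => a z τ) y‖ ≤ A₁ * ε / ((L : ℝ) ^ (k + 1)) ^ 2) ∧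
        (∀ (τ i l : Fin d), ‖fd i (fd l (fun z => a z τ)) x‖ ≤ A₂ * ε / ((L : ℝ) ^ (k + 1)) ^ 3)) :
    LeafH3sup d L N ε ε ((2 * A₂ + 90 * A₀ * A₁ + 32 * A₁ ^ 2 + 360 * A₀ ^ 3) * ε) dom := by
  intro V hV k U hU
  obtain ⟨hu, hp, hs⟩ := hU.mem.1
  have hL1 : (1 : ℝ) ≤ L := by exact_mod_cast hL
  have ht : (1 : ℝ) ≤ (L : ℝ) ^ (k + 1) := one_le_pow₀ hL1
  have hα₀ : 0 ≤ A₀ * ε / (L : ℝ) ^ (k + 1) := by positivity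
  have hα₁ : 0 ≤ A₁ * ε / ((L : ℝ) ^ (k + 1)) ^ 2 := by positivity
  have hα₀' : A₀ * ε / (L : ℝ) ^ (k + 1) ≤ 1 / 8 := (div_le_self (by positivity) ht).trans hA₀ε
  have hα₁' : A₁ * ε / ((L : ℝ) ^ (k + 1)) ^ 2 ≤ 1 / 8 := (div_le_self (by positivity) (one_le_pow₀ ht)).trans hA₁ε
  exact regularSup_of_localGauge hL hu hp hs hε2 hα₀ hα₁ hα₀' hα₁' (fun x => h9 V hV k U hU x)
    (level_arith ht hε (by linarith) hA₀ hA₁ hA₀ε hA₁ε)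

/-- **THE SHAPE OF `stub_h7` FROM THE (9)-TYPE FAMILY HYPOTHESIS** (any `d`, `L ≥ 1`, `N`, `dom`): if there are constants `A₀, A₁, A₂ ≥ 0` and `a > 0` — chosen BEFORE
`ε`, print's quantifier order «The constants a₀, a₁, B₃ depend on d and L only» — such that for every `0 < ε ≤ a` every minimiser of every run `k+1` admits the
(9)_{β₀=1}-TYPE local gauges of `leafH3sup_of_reg9AtMinimisers`, then `∃ C ε₀, 0 ≤ C ∧ 0 < ε₀ ∧ ∀ ε, 0 < ε → ε ≤ ε₀ → LeafH3sup d L N ε (Cε) (Cε) dom`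
with `C = max 1 (2A₂ + 90A₀A₁ + 32A₁² + 360A₀³)`, `ε₀ = min a (min (1∕2) (1∕(8(A₀ + A₁ + 1))))`. [folklore] -/
theorem h7Shape_of_reg9AtMinimisers [Nonempty n] {L N : ℕ} (hL : 1 ≤ L) {dom : Set (Site d → Fin d → (Matrix n n ℂ)ˣ)}
    (h9 : ∃ A₀ A₁ A₂ a : ℝ, 0 ≤ A₀ ∧ 0 ≤ A₁ ∧ 0 ≤ A₂ ∧ 0 < a ∧ ∀ ε : ℝ, 0 < ε → ε ≤ a →
      ∀ V ∈ dom, ∀ (k : ℕ) (U : Site d → Fin d → (Matrix n n ℂ)ˣ), IsMinimiser d (sfClass d L N ε) L N (k + 1) V U →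
        ∀ x : Site d, ∃ (u : Site d → (Matrix n n ℂ)ˣ) (a : Site d → Fin d → Matrix n n ℂ),
          (∀ z, u z ∈ unitaryUnits (Matrix n n ℂ)) ∧
          (∀ (y : Site d) (τ : Fin d), l1 (y - x) ≤ 2 → ((gaugeAct u U y τ : (Matrix n n ℂ)ˣ) : Matrix n n ℂ) = exp (a y τ)) ∧
          (∀ (y : Site d) (τ : Fin d), l1 (y - x) ≤ 2 → ‖a y τ‖ ≤ A₀ * ε / (L : ℝ) ^ (k + 1)) ∧
          (∀ (y : Site d) (τ i : Fin d), l1 (y - x) ≤ 1 → ‖fd i (fun z => a z τ) y‖ ≤ A₁ * ε / ((L : ℝ) ^ (k + 1)) ^ 2) ∧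
          (∀ (τ i l : Fin d), ‖fd i (fd l (fun z => a z τ)) x‖ ≤ A₂ * ε / ((L : ℝ) ^ (k + 1)) ^ 3)) :
    ∃ C ε₀ : ℝ, 0 ≤ C ∧ 0 < ε₀ ∧ ∀ ε : ℝ, 0 < ε → ε ≤ ε₀ → LeafH3sup d L N ε (C * ε) (C * ε) dom := by
  obtain ⟨A₀, A₁, A₂, a, hA₀, hA₁, -, ha, h9⟩ := h9
  set C' : ℝ := 2 * A₂ + 90 * A₀ * A₁ + 32 * A₁ ^ 2 + 360 * A₀ ^ 3 with hC'
  have hS : 0 < 8 * (A₀ + A₁ + 1) := by positivity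
  refine ⟨max 1 C', min a (min (1 / 2) (1 / (8 * (A₀ + A₁ + 1)))), le_trans zero_le_one (le_max_left _ _),
    lt_min ha (lt_min (by norm_num) (by positivity)), fun ε hε hεle => ?_⟩
  have hεa : ε ≤ a := hεle.trans (min_le_left _ _)
  have hε2 : ε ≤ 1 / 2 := hεle.trans ((min_le_right _ _).trans (min_le_left _ _))
  have hεS : ε ≤ 1 / (8 * (A₀ + A₁ + 1)) := hεle.trans ((min_le_right _ _).trans (min_le_right _ _))
  have hεS' : ε * (8 * (A₀ + A₁ + 1)) ≤ 1 := by rwa [le_div_iff₀ hS] at hεS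
  have hA₀ε : A₀ * ε ≤ 1 / 8 := by nlinarith
  have hA₁ε : A₁ * ε ≤ 1 / 8 := by nlinarith
  have hleaf := leafH3sup_of_reg9AtMinimisers hL hε.le hε2 hA₀ hA₁ hA₀ε hA₁ε (h9 ε hε hεa)
  refine leafH3sup_mono hleaf ?_ ?_
  · exact le_mul_of_one_le_left hε.le (le_max_left _ _)
  · exact mul_le_mul_of_nonneg_right (le_max_right _ _) hε.le

/-- **`stub_h7`'S STATEMENT, LITERALLY, FROM THE (9)-TYPE FAMILY HYPOTHESIS AT THE RECORD'S NE3 OBJECTS** (d = 4, `L = F.L`, period of record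
`ne3NperOfRecord₁₁ F 0 0 = 2·L^m`, data of record `ne3DomOfRecord₁₁ F N 0 0` = all `2L^m`-periodic `SU(N)`-valued unit-lattice configurations, `Node00/RateRecord11NE3Data`):
dag-n16-e's knit slot for the N07 edge — ONE `exact` once the (9)-TYPE gauges at these minimisers are supplied (by a discharge of [Balaban1985Variational] Thm 1 at
these objects; see §3 and the LOCATED paragraph of the module header for what print does and does not supply). [folklore] -/
theorem h7_at_record_of_reg9AtMinimisers {N : ℕ} [NeZero N] (F : T4Family)
    (h9 : ∃ A₀ A₁ A₂ a : ℝ, 0 ≤ A₀ ∧ 0 ≤ A₁ ∧ 0 ≤ A₂ ∧ 0 < a ∧ ∀ ε : ℝ, 0 < ε → ε ≤ a →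
      ∀ V ∈ ne3DomOfRecord₁₁ F N 0 0, ∀ (k : ℕ) (U : Site 4 → Fin 4 → (MatA N)ˣ),
        IsMinimiser 4 (sfClass 4 F.L (ne3NperOfRecord₁₁ F 0 0) ε) F.L (ne3NperOfRecord₁₁ F 0 0) (k + 1) V U →
        ∀ x : Site 4, ∃ (u : Site 4 → (MatA N)ˣ) (a : Site 4 → Fin 4 → MatA N),
          (∀ z, u z ∈ unitaryUnits (MatA N)) ∧
          (∀ (y : Site 4) (τ : Fin 4), l1 (y - x) ≤ 2 → ((gaugeAct u U y τ : (MatA N)ˣ) : MatA N) = exp (a y τ)) ∧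
          (∀ (y : Site 4) (τ : Fin 4), l1 (y - x) ≤ 2 → ‖a y τ‖ ≤ A₀ * ε / (F.L : ℝ) ^ (k + 1)) ∧
          (∀ (y : Site 4) (τ i : Fin 4), l1 (y - x) ≤ 1 → ‖fd i (fun z => a z τ) y‖ ≤ A₁ * ε / ((F.L : ℝ) ^ (k + 1)) ^ 2) ∧
          (∀ (τ i l : Fin 4), ‖fd i (fd l (fun z => a z τ)) x‖ ≤ A₂ * ε / ((F.L : ℝ) ^ (k + 1)) ^ 3)) :
    ∃ C ε₀ : ℝ, 0 ≤ C ∧ 0 < ε₀ ∧ ∀ ε : ℝ, 0 < ε → ε ≤ ε₀ →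
      LeafH3sup 4 F.L (ne3NperOfRecord₁₁ F 0 0) ε (C * ε) (C * ε) (ne3DomOfRecord₁₁ F N 0 0) :=
  h7Shape_of_reg9AtMinimisers (le_of_lt F.hL.2) h9

/-! ## §3 [B11] Theorem 1 read at leaf-06's torus instances ⟹ `h7` on LOOSE data -/

/-- **★ [B11] THEOREM 1 AT THE TORUS INSTANCES ⟹ THE LEAF (H3ˢᵘᵖ) ON LOOSE DATA.**  Let `L ≥ 1`; `G` a local-gauge shape monotone in its radii (`hGm`) which, on a
cube `box K x` with `K ≥ 2`, supplies a unitary gauge `u` and potential `a` with `U^u = exp a`, `‖a‖ ≤ α₀` on the bonds within `|·|₁ ≤ 2` of the centre `x`,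
`‖∇a‖ ≤ α₁` within `1`, and `‖∇∇a(x)‖ ≤ α₂` (`hG`: (9)_{β₀=1} sup data); `C : B11Thm1.Consts` with `M(e) ≥ 7∕2` for `0 < e ≤ a₁` (`hM`); and THEOREM 1 OF
[Balaban1985Variational] AT THE CONSTANTS `C` FOR THE TORUS INSTANCES OF ALL RUNS `k+1` — `hT : ∀ k, B11Thm1.Thm1At C (MinimalActionDictionary.torusVP d L N G (k+1))`
(a DISPLAYED HYPOTHESIS; divergences D-s3-1…6 of that instance).  THEN for `0 < ε ≤ min(B₃·a₁, 1∕28)` and every `dom`: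
`LeafH3sup d L N ε ε (16937·ε) {V | V ∈ dom ∧ V ∈ sfClass d L N (ε∕B₃) 0}`.  Proof: Theorem 1 at `ε₁ := ε∕B₃` (then (8)'s class `sfClass d L N (B₃ε₁) (k+1)` IS the
tree's class of radius `ε`, so the tree's minimiser is `OnMinimalOrbit (B₃ε₁) V U` by `rfl`); (7) is the LOOSE-DATA condition `V ∈ sfClass d L N (ε∕B₃) 0`; the
regularity clause on the cube `(x, K)`, `K = L^{k+1} − 1 + L^{k+1} + 2` (`cubeM ≤ 7∕2 ≤ M(ε₁)`, `cubeM_slot_le`), gives through `gauge_of_regularity` the shape `G` with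
common factor `t = 7ε∕2`, `hG` the per-site data, and §2 (`regularSup_of_localGauge` + `level_arith` at `A₀ = A₁ = A₂ = 7∕2`: `7 + 1102.5 + 392 + 15435 = 16936.5 ≤ 16937`;
`ε ≤ 1∕28` makes the radii `≤ 1∕8`).  What this is NOT: `h7` on ALL data (A2 of the header), nor a statement about print's (2)-class minimal orbits (A1). [cite: Balaban1985Variational, Thm 1 (8)–(10) p.279] -/
theorem leafH3sup_loose_of_thm1At_torusVP [Nonempty n] {L N : ℕ} (hL : 1 ≤ L)
    {G : (Site d → Fin d → (Matrix n n ℂ)ˣ) → Site d → ℕ → ℝ → ℝ → ℝ → Prop} (hGm : RadiiMono d G)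
    (hG : ∀ (U : Site d → Fin d → (Matrix n n ℂ)ˣ) (x : Site d) (K : ℕ) (α₀ α₁ α₂ : ℝ), 2 ≤ K → G U x K α₀ α₁ α₂ →
      ∃ (u : Site d → (Matrix n n ℂ)ˣ) (a : Site d → Fin d → Matrix n n ℂ),
        (∀ z, u z ∈ unitaryUnits (Matrix n n ℂ)) ∧
        (∀ (y : Site d) (τ : Fin d), l1 (y - x) ≤ 2 → ((gaugeAct u U y τ : (Matrix n n ℂ)ˣ) : Matrix n n ℂ) = exp (a y τ)) ∧
        (∀ (y : Site d) (τ : Fin d), l1 (y - x) ≤ 2 → ‖a y τ‖ ≤ α₀) ∧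
        (∀ (y : Site d) (τ i : Fin d), l1 (y - x) ≤ 1 → ‖fd i (fun z => a z τ) y‖ ≤ α₁) ∧
        (∀ (τ i l : Fin d), ‖fd i (fd l (fun z => a z τ)) x‖ ≤ α₂))
    (C : B11Thm1.Consts) (hM : ∀ e : ℝ, 0 < e → e ≤ C.a₁ → 7 / 2 ≤ C.Mfun e)
    (hT : ∀ k : ℕ, Thm1At C (torusVP d L N G (k + 1)))
    {ε : ℝ} (hε : 0 < ε) (hεa : ε ≤ C.B₃ * C.a₁) (hε28 : ε ≤ 1 / 28)
    (dom : Set (Site d → Fin d → (Matrix n n ℂ)ˣ)) :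
    LeafH3sup d L N ε ε (16937 * ε) {V | V ∈ dom ∧ V ∈ sfClass d L N (ε / C.B₃) 0} := by
  have hB₃ := C.B₃_pos
  have hε₁ : 0 < ε / C.B₃ := div_pos hε hB₃
  have hε₁a : ε / C.B₃ ≤ C.a₁ := by rw [div_le_iff₀ hB₃]; linarith [mul_comm C.B₃ C.a₁]
  have hBε : C.B₃ * (ε / C.B₃) = ε := by field_simp
  have hAε : (7 / 2 : ℝ) * ε ≤ 1 / 8 := by linarith
  -- the (9)-TYPE gauges at every minimiser with a loose datum, from Theorem 1 at `ε₁ := ε / B₃`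
  have h9 : ∀ V ∈ {V | V ∈ dom ∧ V ∈ sfClass d L N (ε / C.B₃) 0}, ∀ (k : ℕ) (U : Site d → Fin d → (Matrix n n ℂ)ˣ),
      IsMinimiser d (sfClass d L N ε) L N (k + 1) V U →
      ∀ x : Site d, ∃ (u : Site d → (Matrix n n ℂ)ˣ) (a : Site d → Fin d → Matrix n n ℂ),
        (∀ z, u z ∈ unitaryUnits (Matrix n n ℂ)) ∧
        (∀ (y : Site d) (τ : Fin d), l1 (y - x) ≤ 2 → ((gaugeAct u U y τ : (Matrix n n ℂ)ˣ) : Matrix n n ℂ) = exp (a y τ)) ∧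
        (∀ (y : Site d) (τ : Fin d), l1 (y - x) ≤ 2 → ‖a y τ‖ ≤ 7 / 2 * ε / (L : ℝ) ^ (k + 1)) ∧
        (∀ (y : Site d) (τ i : Fin d), l1 (y - x) ≤ 1 → ‖fd i (fun z => a z τ) y‖ ≤ 7 / 2 * ε / ((L : ℝ) ^ (k + 1)) ^ 2) ∧
        (∀ (τ i l : Fin d), ‖fd i (fd l (fun z => a z τ)) x‖ ≤ 7 / 2 * ε / ((L : ℝ) ^ (k + 1)) ^ 3) := by
    rintro V ⟨-, hV7⟩ k U hU x
    obtain ⟨-, -, h910⟩ := hT k (ε / C.B₃) hε₁ hε₁a V hV7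
    have hmin : (torusVP d L N G (k + 1)).OnMinimalOrbit (C.B₃ * (ε / C.B₃)) V U := by
      show IsMinimiser d (sfClass d L N (C.B₃ * (ε / C.B₃))) L N (k + 1) V U
      rw [hBε]; exact hU
    -- the regularity cube about `x`: `K = L^{k+1} − 1 + L^{k+1} + 2`, `cubeM ≤ 7/2 ≤ M(ε₁)`
    have hK2 : 2 ≤ L ^ (k + 1) - 1 + L ^ (k + 1) + 2 := by omega
    have hsize : cubeM L (k + 1) (L ^ (k + 1) - 1 + L ^ (k + 1) + 2) ≤ 7 / 2 := cubeM_slot_le hL (k + 1)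
    have hsizeM : (torusVP d L N G (k + 1)).sizeM (x, L ^ (k + 1) - 1 + L ^ (k + 1) + 2) ≤ C.Mfun (ε / C.B₃) :=
      hsize.trans (hM _ hε₁ hε₁a)
    have hreg : Regularity (torusVP d L N G (k + 1)) C.B₃ C.B₄ (ε / C.B₃) U (x, L ^ (k + 1) - 1 + L ^ (k + 1) + 2) :=
      h910 U hmin _ hsizeM
    have hc : C.B₃ * cubeM L (k + 1) (L ^ (k + 1) - 1 + L ^ (k + 1) + 2) * (ε / C.B₃) ≤ 7 / 2 * ε := by
      have h1 : C.B₃ * cubeM L (k + 1) (L ^ (k + 1) - 1 + L ^ (k + 1) + 2) * (ε / C.B₃)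
          = cubeM L (k + 1) (L ^ (k + 1) - 1 + L ^ (k + 1) + 2) * ε := by field_simp
      rw [h1]; exact mul_le_mul_of_nonneg_right hsize hε.le
    exact hG U x _ _ _ _ hK2 (gauge_of_regularity hGm hL hreg hc)
  -- §2's dictionary at `A₀ = A₁ = A₂ = 7/2`, then the numeral
  have hleaf := leafH3sup_of_reg9AtMinimisers hL hε.le (by linarith) (by norm_num : (0 : ℝ) ≤ 7 / 2) (by norm_num : (0 : ℝ) ≤ 7 / 2)
    hAε hAε h9
  refine leafH3sup_mono hleaf le_rfl ?_
  have hnum : (2 * (7 / 2 : ℝ) + 90 * (7 / 2) * (7 / 2) + 32 * (7 / 2) ^ 2 + 360 * (7 / 2) ^ 3) ≤ 16937 := by norm_num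
  exact mul_le_mul_of_nonneg_right hnum hε.le

/-- **THE `∃ C ε₀` SHAPE ON LOOSE DATA** from Theorem 1 at the torus instances: `C = 16937`, `ε₀ = min(B₃a₁, 1∕28)`, the data set restricted to
`V ∈ sfClass d L N (ε∕B₃) 0` (print's hypothesis (7) at `ε₁ = ε∕B₃`).  The restriction is ε-DEPENDENT — this is NOT `stub_h7` (header, A2). [cite: Balaban1985Variational, Thm 1 p.279] -/
theorem h7Shape_loose_of_thm1At_torusVP [Nonempty n] {L N : ℕ} (hL : 1 ≤ L)
    {G : (Site d → Fin d → (Matrix n n ℂ)ˣ) → Site d → ℕ → ℝ → ℝ → ℝ → Prop} (hGm : RadiiMono d G)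
    (hG : ∀ (U : Site d → Fin d → (Matrix n n ℂ)ˣ) (x : Site d) (K : ℕ) (α₀ α₁ α₂ : ℝ), 2 ≤ K → G U x K α₀ α₁ α₂ →
      ∃ (u : Site d → (Matrix n n ℂ)ˣ) (a : Site d → Fin d → Matrix n n ℂ),
        (∀ z, u z ∈ unitaryUnits (Matrix n n ℂ)) ∧
        (∀ (y : Site d) (τ : Fin d), l1 (y - x) ≤ 2 → ((gaugeAct u U y τ : (Matrix n n ℂ)ˣ) : Matrix n n ℂ) = exp (a y τ)) ∧
        (∀ (y : Site d) (τ : Fin d), l1 (y - x) ≤ 2 → ‖a y τ‖ ≤ α₀) ∧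
        (∀ (y : Site d) (τ i : Fin d), l1 (y - x) ≤ 1 → ‖fd i (fun z => a z τ) y‖ ≤ α₁) ∧
        (∀ (τ i l : Fin d), ‖fd i (fd l (fun z => a z τ)) x‖ ≤ α₂))
    (C : B11Thm1.Consts) (hM : ∀ e : ℝ, 0 < e → e ≤ C.a₁ → 7 / 2 ≤ C.Mfun e)
    (hT : ∀ k : ℕ, Thm1At C (torusVP d L N G (k + 1)))
    (dom : Set (Site d → Fin d → (Matrix n n ℂ)ˣ)) :
    ∃ C' ε₀ : ℝ, 0 ≤ C' ∧ 0 < ε₀ ∧ ∀ ε : ℝ, 0 < ε → ε ≤ ε₀ →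
      LeafH3sup d L N ε (C' * ε) (C' * ε) {V | V ∈ dom ∧ V ∈ sfClass d L N (ε / C.B₃) 0} := by
  refine ⟨16937, min (C.B₃ * C.a₁) (1 / 28), by norm_num, lt_min (mul_pos C.B₃_pos C.a₁_pos) (by norm_num), fun ε hε hεle => ?_⟩
  have h := leafH3sup_loose_of_thm1At_torusVP hL hGm hG C hM hT hε (hεle.trans (min_le_left _ _)) (hεle.trans (min_le_right _ _)) dom
  exact leafH3sup_mono h (by nlinarith) le_rfl

/-! ### The interface binders are inhabited by the (9)_{β₀=1} sup shape on cubes (A6 hygiene) -/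

/-- The (9)_{β₀=1} sup shape on the cube `box K y` — «a unitary gauge `u` and a potential `a` with `U^u = exp a`, `‖a‖ ≤ α₀`, `‖∇a‖ ≤ α₁`, `‖∇∇a‖ ≤ α₂` on
`box K y`» (written out; no `def`) — is monotone in its radii. [folklore] -/
theorem radiiMono_lipGauge :
    RadiiMono d (fun (U : Site d → Fin d → (Matrix n n ℂ)ˣ) (y : Site d) (K : ℕ) (α₀ α₁ α₂ : ℝ) =>
      ∃ (u : Site d → (Matrix n n ℂ)ˣ) (a : Site d → Fin d → Matrix n n ℂ), (∀ z, u z ∈ unitaryUnits (Matrix n n ℂ)) ∧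
        (∀ (z : Site d) (τ : Fin d), z ∈ box K y → ((gaugeAct u U z τ : (Matrix n n ℂ)ˣ) : Matrix n n ℂ) = exp (a z τ)) ∧
        (∀ (z : Site d) (τ : Fin d), z ∈ box K y → ‖a z τ‖ ≤ α₀) ∧
        (∀ (z : Site d) (τ i : Fin d), z ∈ box K y → ‖fd i (fun w => a w τ) z‖ ≤ α₁) ∧
        (∀ (z : Site d) (τ i l : Fin d), z ∈ box K y → ‖fd i (fd l (fun w => a w τ)) z‖ ≤ α₂)) := by
  rintro U y K a₀ a₁ a₂ b₀ b₁ b₂ h0 h1 h2 ⟨u, a, hu, he, ha0, ha1, ha2⟩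
  exact ⟨u, a, hu, he, fun z τ hz => (ha0 z τ hz).trans h0, fun z τ i hz => (ha1 z τ i hz).trans h1,
    fun z τ i l hz => (ha2 z τ i l hz).trans h2⟩

/-- The (9)_{β₀=1} sup shape on `box K x`, `K ≥ 2`, supplies the per-site data of `leafH3sup_loose_of_thm1At_torusVP`'s binder `hG` at the centre `x`
(the bonds within `|·|₁ ≤ 2` of `x` lie in `box 2 x ⊆ box K x`). [folklore] -/
theorem interface_lipGauge (U : Site d → Fin d → (Matrix n n ℂ)ˣ) (x : Site d) (K : ℕ) (α₀ α₁ α₂ : ℝ) (hK : 2 ≤ K)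
    (h : ∃ (u : Site d → (Matrix n n ℂ)ˣ) (a : Site d → Fin d → Matrix n n ℂ), (∀ z, u z ∈ unitaryUnits (Matrix n n ℂ)) ∧
        (∀ (z : Site d) (τ : Fin d), z ∈ box K x → ((gaugeAct u U z τ : (Matrix n n ℂ)ˣ) : Matrix n n ℂ) = exp (a z τ)) ∧
        (∀ (z : Site d) (τ : Fin d), z ∈ box K x → ‖a z τ‖ ≤ α₀) ∧
        (∀ (z : Site d) (τ i : Fin d), z ∈ box K x → ‖fd i (fun w => a w τ) z‖ ≤ α₁) ∧
        (∀ (z : Site d) (τ i l : Fin d), z ∈ box K x → ‖fd i (fd l (fun w => a w τ)) z‖ ≤ α₂)) :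
    ∃ (u : Site d → (Matrix n n ℂ)ˣ) (a : Site d → Fin d → Matrix n n ℂ),
      (∀ z, u z ∈ unitaryUnits (Matrix n n ℂ)) ∧
      (∀ (y : Site d) (τ : Fin d), l1 (y - x) ≤ 2 → ((gaugeAct u U y τ : (Matrix n n ℂ)ˣ) : Matrix n n ℂ) = exp (a y τ)) ∧
      (∀ (y : Site d) (τ : Fin d), l1 (y - x) ≤ 2 → ‖a y τ‖ ≤ α₀) ∧
      (∀ (y : Site d) (τ i : Fin d), l1 (y - x) ≤ 1 → ‖fd i (fun z => a z τ) y‖ ≤ α₁) ∧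
      (∀ (τ i l : Fin d), ‖fd i (fd l (fun z => a z τ)) x‖ ≤ α₂) := by
  obtain ⟨u, a, hu, he, h0, h1, h2⟩ := h
  have hmem : ∀ {y : Site d} {m : ℕ}, l1 (y - x) ≤ m → m ≤ K → y ∈ box K x := fun {y m} hy hm =>
    box_mono (by omega) x (mem_box_add_of_l1 (self_mem_box 0 x) hy)
  exact ⟨u, a, hu, fun y τ hy => he y τ (hmem hy hK), fun y τ hy => h0 y τ (hmem hy hK),
    fun y τ i hy => h1 y τ i (hmem hy (by omega)), fun τ i l => h2 x τ i l (self_mem_box K x)⟩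

end

end Summit.QuantumFields.YangMills.BalabanUVNodes.N16H7OfReg9
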